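import Summits.SmoothPoincare4.SmoothPoincare4.Theorems.ConvexBisectionAcyclicBisectionExistsHgapTwistChart3
import HarnessLib

/-!
# Hgap ▸ part B (page twisting of the straightened dual framed knot), brick H1-b (sphere side):
# the columns of the three-dimensional belt-tube chart at a belt point
(wave 7, crux stmt-SmoothPoincare4-10508, line `modp-braid-orbits`, stub `stub_T3_dualPresentation` (T3)
▸ node `Hgap` ▸ part B `helper_Hgap_twisting` ▸ (R6d′); registered sub-goal `helper_beltChar_at_belt`)

For the three-dimensional belt-tube chart `Γ̂ (p) = (E (seam (β♭ (circlePt (p 2), L p)))).1` of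
`…HgapTwistChart3.lean` (`β♭ = (beltMap D j).boundaryTube`, `L p = (p 0, p 1)`), this file identifies the
three columns of `dΓ̂` at a BELT point `p₀ = (0, 0, φ) = EuclideanSpace.single 2 φ`:

* `dΓ̂ e₀ = Λ e₀`, `dΓ̂ e₁ = Λ e₁` with `Λ = ∂_m|₀ (E (seam (β♭ (circlePt φ, m)))).1` the fibre derivative of
  the two-dimensional chart (the `Λ` of `helper_dualFraming_chart`, `pageTwistingLoop_transport_dualMap`,
  `helper_det4_beltFrame_sign`) — chain rule through the affine plane `m ↦ p₀ + (m, 0)`;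
* `dΓ̂ e₂ = T := (ambCurve g (E ∘ dual circle))' (φ)` — chain rule through the line `t ↦ single 2 t`
  (`mfderiv_beltChart₃_single`);

hence **`χ (p₀) = det4 (∇rho (Γ_φ 0), Λ e₀, Λ e₁, T)`** (`beltChar_at_belt`, registered
`helper_beltChar_at_belt`): the orientation character of the chart at the belt circle is the quantity whose
sign `helper_det4_beltFrame_sign` computes (the page sign `σ̂`).  Riders for the assembly: `T ≠ 0`,
`d rho (Λ X) = 0`, and `Λ X = a T ⇒ X = 0` (`beltFrame_T_ne_zero`, `beltFrame_rho`, `beltFrame_inj`) — the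
hypotheses `hT0`, `hρ`, `hinj` of `helper_det4_beltFrame_sign`, all from the injectivity of `dΓ̂`
(`injective_mfderiv_beltChart₃`).

Everything is proved; no named facts, no `sorry`.  References: A. A. Kosinski, *Differential Manifolds*
(1993), VI §6 [Kosinski1993]; J. M. Lee, *Introduction to Smooth Manifolds* (2013), Prop. 3.9 [LeeSmoothManifolds2013].
-/

noncomputable section

set_option linter.dupNamespace false

open scoped Manifold ContDiff Topology
open Set Function Metric
open Literature.Topology.FourManifolds Literature.Topology.FourManifolds.HandleAttachingMap
  Literature.Topology.FourManifolds.LefschetzBase Literature.Geometry.Symplectic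

namespace Summit.SmoothPoincare4.SmoothPoincare4.Theorems.AcyclicBisectionExists.ModpBraidOrbits

/-! ## §1 Linear algebra of the source `ℝ³ = ℝ² × ℝ` -/

/-- The embedding `X ↦ (X 0, X 1, 0)` of the fibre plane into the source, as a continuous linear map.
[folklore] -/
theorem exists_embL3 : ∃ A : EuclideanSpace ℝ (Fin 2) →L[ℝ] EuclideanSpace ℝ (Fin 3),
    ∀ X : EuclideanSpace ℝ (Fin 2), A X = X 0 • EuclideanSpace.single (0 : Fin 3) (1 : ℝ) +
      X 1 • EuclideanSpace.single (1 : Fin 3) (1 : ℝ) :=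
  ⟨(EuclideanSpace.proj (𝕜 := ℝ) (0 : Fin 2)).smulRight (EuclideanSpace.single (0 : Fin 3) (1 : ℝ)) +
    (EuclideanSpace.proj (𝕜 := ℝ) (1 : Fin 2)).smulRight (EuclideanSpace.single (1 : Fin 3) (1 : ℝ)),
    fun X => by simp [ContinuousLinearMap.smulRight_apply]⟩

/-- Coordinates of the embedded fibre vector: last coordinate `0`. [folklore] -/
theorem embL3_apply_two (X : EuclideanSpace ℝ (Fin 2)) :
    (X 0 • EuclideanSpace.single (0 : Fin 3) (1 : ℝ) + X 1 • EuclideanSpace.single (1 : Fin 3) (1 : ℝ)) 2 = 0 := by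
  simp

/-- Coordinates of the embedded fibre vector: first two coordinates `X`. [folklore] -/
theorem embL3_apply_castSucc (X : EuclideanSpace ℝ (Fin 2)) (i : Fin 2) :
    (X 0 • EuclideanSpace.single (0 : Fin 3) (1 : ℝ) + X 1 • EuclideanSpace.single (1 : Fin 3) (1 : ℝ))
      (Fin.castSucc i) = X i := by
  fin_cases i <;> simp

/-- The fibre part of the embedded fibre vector is the vector itself. [folklore] -/
theorem lamL3_embL3 {L : EuclideanSpace ℝ (Fin 3) →L[ℝ] EuclideanSpace ℝ (Fin 2)}
    (hL : ∀ (p : EuclideanSpace ℝ (Fin 3)) (i : Fin 2), L p i = p (Fin.castSucc i)) (φ : ℝ)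
    (X : EuclideanSpace ℝ (Fin 2)) :
    L (EuclideanSpace.single (2 : Fin 3) φ + (X 0 • EuclideanSpace.single (0 : Fin 3) (1 : ℝ) +
      X 1 • EuclideanSpace.single (1 : Fin 3) (1 : ℝ))) = X := by
  ext i
  rw [hL, PiLp.add_apply, embL3_apply_castSucc]
  have : (EuclideanSpace.single (2 : Fin 3) φ) (Fin.castSucc i) = 0 := by
    fin_cases i <;> simp
  rw [this, zero_add]

/-- The fibre part of a belt point `single 2 φ` vanishes. [folklore] -/
theorem lamL3_single {L : EuclideanSpace ℝ (Fin 3) →L[ℝ] EuclideanSpace ℝ (Fin 2)}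
    (hL : ∀ (p : EuclideanSpace ℝ (Fin 3)) (i : Fin 2), L p i = p (Fin.castSucc i)) (φ : ℝ) :
    L (EuclideanSpace.single (2 : Fin 3) φ) = 0 := by
  ext i
  rw [hL]
  fin_cases i <;> simp

/-- The angle coordinate of `single 2 φ + (X, 0)` is `φ`. [folklore] -/
theorem single_add_embL3_apply_two (φ : ℝ) (X : EuclideanSpace ℝ (Fin 2)) :
    (EuclideanSpace.single (2 : Fin 3) φ + (X 0 • EuclideanSpace.single (0 : Fin 3) (1 : ℝ) +
      X 1 • EuclideanSpace.single (1 : Fin 3) (1 : ℝ))) 2 = φ := by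
  rw [PiLp.add_apply, embL3_apply_two, add_zero]
  simp

/-- The line `t ↦ single 2 t` has velocity `single 2 1`. [folklore] -/
theorem hasDerivAt_single_two (φ : ℝ) :
    HasDerivAt (fun t : ℝ => EuclideanSpace.single (2 : Fin 3) t) (EuclideanSpace.single (2 : Fin 3) (1 : ℝ)) φ := by
  have e : (fun t : ℝ => EuclideanSpace.single (2 : Fin 3) t) =
      fun t : ℝ => t • EuclideanSpace.single (2 : Fin 3) (1 : ℝ) := by
    funext t; ext i; simp
  rw [e]
  simpa using (hasDerivAt_id φ).smul_const (EuclideanSpace.single (2 : Fin 3) (1 : ℝ))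

/-! ## §2 The columns of the chart at a belt point -/

section Chart

variable {g : ℕ} {ι : Type} [Finite ι] {h : ι → HandleAttachingMap 3 2 (Base g)}
  {X : Type} [TopologicalSpace X] [ChartedSpace (EuclideanHalfSpace 4) X] [IsManifold (𝓡∂ 4) ∞ X]
  (D : MultiAttachmentData h (𝓡∂ 4) X) (bX : BoundaryData (𝓡∂ 4) X (𝓡 3))
  (Ψ : bX.carrier ≃ₘ⟮𝓡 3, 𝓡 3⟯ (bBase g).carrier) (E : Base g ≃ₘ^∞⟮𝓡∂ 4, 𝓡∂ 4⟯ Base g) (j : ι)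
  {L : EuclideanSpace ℝ (Fin 3) →L[ℝ] EuclideanSpace ℝ (Fin 2)}

/-- **The chart on the affine fibre plane through a belt point is the two-dimensional chart**:
`Γ̂ (single 2 φ + (m, 0)) = (E (seam (β♭ (circlePt φ, m)))).1`. [folklore] -/
theorem beltChart₃_single_add_embL3
    (hL : ∀ (p : EuclideanSpace ℝ (Fin 3)) (i : Fin 2), L p i = p (Fin.castSucc i)) (φ : ℝ)
    (m : EuclideanSpace ℝ (Fin 2)) :
    (fun p : EuclideanSpace ℝ (Fin 3) => (E ((BoundaryManifold.boundaryData 3 (Base g)).incl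
        (seamDiffeo bX (bBase g) Ψ ((beltMap D j).boundaryTube.toHomeo (circlePt (p 2), L p))))).1)
      (EuclideanSpace.single (2 : Fin 3) φ + (m 0 • EuclideanSpace.single (0 : Fin 3) (1 : ℝ) +
        m 1 • EuclideanSpace.single (1 : Fin 3) (1 : ℝ))) =
    (E ((BoundaryManifold.boundaryData 3 (Base g)).incl (seamDiffeo bX (bBase g) Ψ
      ((beltMap D j).boundaryTube.toHomeo (circlePt φ, m))))).1 := by
  simp only []
  rw [single_add_embL3_apply_two, lamL3_embL3 hL]

/-- **The chart at a belt point is the dual circle point**: `Γ̂ (single 2 φ) = (E (seam (β♭ (circlePt φ, 0)))).1`.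
[folklore] -/
theorem beltChart₃_single
    (hL : ∀ (p : EuclideanSpace ℝ (Fin 3)) (i : Fin 2), L p i = p (Fin.castSucc i)) (φ : ℝ) :
    (fun p : EuclideanSpace ℝ (Fin 3) => (E ((BoundaryManifold.boundaryData 3 (Base g)).incl
        (seamDiffeo bX (bBase g) Ψ ((beltMap D j).boundaryTube.toHomeo (circlePt (p 2), L p))))).1)
      (EuclideanSpace.single (2 : Fin 3) φ) =
    (E ((BoundaryManifold.boundaryData 3 (Base g)).incl (seamDiffeo bX (bBase g) Ψ
      ((beltMap D j).boundaryTube.toHomeo (circlePt φ, (0 : EuclideanSpace ℝ (Fin 2))))))).1 := by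
  simp only []
  rw [lamL3_single hL]
  have : (EuclideanSpace.single (2 : Fin 3) φ) 2 = φ := by simp
  rw [this]

/-- **The columns of the three-dimensional belt-tube chart at a belt point** (brick H1-b): at
`p₀ = single 2 φ`, `dΓ̂ e₀ = Λ e₀`, `dΓ̂ e₁ = Λ e₁` (`Λ` the fibre derivative of the two-dimensional chart at
`m = 0`) and `dΓ̂ e₂ = (ambCurve g (E ∘ seam ∘ β♭(·, 0)))' (φ)`. [cite: LeeSmoothManifolds2013, Prop. 3.9] -/
theorem mfderiv_beltChart₃_single
    (hL : ∀ (p : EuclideanSpace ℝ (Fin 3)) (i : Fin 2), L p i = p (Fin.castSucc i)) (φ : ℝ) :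
    (∀ Xv : EuclideanSpace ℝ (Fin 2),
      mfderiv 𝓘(ℝ, EuclideanSpace ℝ (Fin 3)) 𝓘(ℝ, EuclideanSpace ℝ (Fin 4))
          (fun p : EuclideanSpace ℝ (Fin 3) => (E ((BoundaryManifold.boundaryData 3 (Base g)).incl
            (seamDiffeo bX (bBase g) Ψ ((beltMap D j).boundaryTube.toHomeo (circlePt (p 2), L p))))).1)
          (EuclideanSpace.single (2 : Fin 3) φ)
          (Xv 0 • EuclideanSpace.single (0 : Fin 3) (1 : ℝ) + Xv 1 • EuclideanSpace.single (1 : Fin 3) (1 : ℝ)) =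
        fderiv ℝ (fun m : EuclideanSpace ℝ (Fin 2) => (E ((BoundaryManifold.boundaryData 3 (Base g)).incl
          (seamDiffeo bX (bBase g) Ψ ((beltMap D j).boundaryTube.toHomeo (circlePt φ, m))))).1) 0 Xv) ∧
    mfderiv 𝓘(ℝ, EuclideanSpace ℝ (Fin 3)) 𝓘(ℝ, EuclideanSpace ℝ (Fin 4))
        (fun p : EuclideanSpace ℝ (Fin 3) => (E ((BoundaryManifold.boundaryData 3 (Base g)).incl
          (seamDiffeo bX (bBase g) Ψ ((beltMap D j).boundaryTube.toHomeo (circlePt (p 2), L p))))).1)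
        (EuclideanSpace.single (2 : Fin 3) φ) (EuclideanSpace.single (2 : Fin 3) (1 : ℝ)) =
      deriv (ambCurve g (fun θ => E ((BoundaryManifold.boundaryData 3 (Base g)).incl
        (seamDiffeo bX (bBase g) Ψ ((beltMap D j).boundaryTube.toHomeo (θ, (0 : EuclideanSpace ℝ (Fin 2)))))))) φ := by
  have hp0 : ‖L (EuclideanSpace.single (2 : Fin 3) φ)‖ < 1 := by
    rw [lamL3_single hL, norm_zero]; exact one_pos
  obtain ⟨Dp, -, hD⟩ := hasMFDerivAt_beltChart₃ D bX Ψ E j hL (EuclideanSpace.single (2 : Fin 3) φ) hp0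
  have hF := hasMFDerivAt_iff_hasFDerivAt.1 hD
  rw [hD.mfderiv]
  obtain ⟨A, hA⟩ := exists_embL3
  constructor
  · intro Xv
    -- the affine fibre plane through `p₀`
    have haff : HasFDerivAt (fun m : EuclideanSpace ℝ (Fin 2) => EuclideanSpace.single (2 : Fin 3) φ + A m) A 0 :=
      A.hasFDerivAt.const_add (EuclideanSpace.single (2 : Fin 3) φ)
    have h0 : EuclideanSpace.single (2 : Fin 3) φ + A 0 = EuclideanSpace.single (2 : Fin 3) φ := by
      rw [map_zero, add_zero]
    rw [← h0] at hF
    have hcomp := hF.comp (0 : EuclideanSpace ℝ (Fin 2)) haff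
    have heq : ((fun p : EuclideanSpace ℝ (Fin 3) => (E ((BoundaryManifold.boundaryData 3 (Base g)).incl
        (seamDiffeo bX (bBase g) Ψ ((beltMap D j).boundaryTube.toHomeo (circlePt (p 2), L p))))).1) ∘
          fun m : EuclideanSpace ℝ (Fin 2) => EuclideanSpace.single (2 : Fin 3) φ + A m) =
        fun m : EuclideanSpace ℝ (Fin 2) => (E ((BoundaryManifold.boundaryData 3 (Base g)).incl
          (seamDiffeo bX (bBase g) Ψ ((beltMap D j).boundaryTube.toHomeo (circlePt φ, m))))).1 := by
      funext m
      rw [Function.comp_apply, hA m]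
      exact beltChart₃_single_add_embL3 D bX Ψ E j hL φ m
    rw [heq] at hcomp
    rw [hcomp.fderiv, ContinuousLinearMap.comp_apply, hA Xv]
    rfl
  · -- the line `t ↦ single 2 t`
    have hcurve := hF.comp_hasDerivAt_of_eq φ (hasDerivAt_single_two φ) rfl
    have heq : ((fun p : EuclideanSpace ℝ (Fin 3) => (E ((BoundaryManifold.boundaryData 3 (Base g)).incl
        (seamDiffeo bX (bBase g) Ψ ((beltMap D j).boundaryTube.toHomeo (circlePt (p 2), L p))))).1) ∘
          fun t : ℝ => EuclideanSpace.single (2 : Fin 3) t) =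
        ambCurve g (fun θ => E ((BoundaryManifold.boundaryData 3 (Base g)).incl
          (seamDiffeo bX (bBase g) Ψ ((beltMap D j).boundaryTube.toHomeo (θ, (0 : EuclideanSpace ℝ (Fin 2))))))) := by
      funext t
      rw [Function.comp_apply]
      exact beltChart₃_single D bX Ψ E j hL t
    rw [heq] at hcurve
    rw [hcurve.deriv]
    rfl

/-- **The orientation character of the chart at a belt point** (brick H1-b):
`χ (single 2 φ) = det4 (∇rho (Γ_φ 0), Λ e₀, Λ e₁, T)` with `Λ = ∂_m|₀ (E (seam (β♭ (circlePt φ, m)))).1` and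
`T = (ambCurve g (E ∘ seam ∘ β♭(·, 0)))' (φ)` — the quantity of `helper_det4_beltFrame_sign`.
[cite: LeeSmoothManifolds2013, Prop. 3.9] -/
theorem beltChar_at_belt
    (hL : ∀ (p : EuclideanSpace ℝ (Fin 3)) (i : Fin 2), L p i = p (Fin.castSucc i)) (φ : ℝ) :
    det4 (gradient (rho g) ((fun p : EuclideanSpace ℝ (Fin 3) => (E ((BoundaryManifold.boundaryData 3 (Base g)).incl
          (seamDiffeo bX (bBase g) Ψ ((beltMap D j).boundaryTube.toHomeo (circlePt (p 2), L p))))).1)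
          (EuclideanSpace.single (2 : Fin 3) φ)))
        (mfderiv 𝓘(ℝ, EuclideanSpace ℝ (Fin 3)) 𝓘(ℝ, EuclideanSpace ℝ (Fin 4))
          (fun p : EuclideanSpace ℝ (Fin 3) => (E ((BoundaryManifold.boundaryData 3 (Base g)).incl
            (seamDiffeo bX (bBase g) Ψ ((beltMap D j).boundaryTube.toHomeo (circlePt (p 2), L p))))).1)
          (EuclideanSpace.single (2 : Fin 3) φ) (EuclideanSpace.single (0 : Fin 3) (1 : ℝ)))
        (mfderiv 𝓘(ℝ, EuclideanSpace ℝ (Fin 3)) 𝓘(ℝ, EuclideanSpace ℝ (Fin 4))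
          (fun p : EuclideanSpace ℝ (Fin 3) => (E ((BoundaryManifold.boundaryData 3 (Base g)).incl
            (seamDiffeo bX (bBase g) Ψ ((beltMap D j).boundaryTube.toHomeo (circlePt (p 2), L p))))).1)
          (EuclideanSpace.single (2 : Fin 3) φ) (EuclideanSpace.single (1 : Fin 3) (1 : ℝ)))
        (mfderiv 𝓘(ℝ, EuclideanSpace ℝ (Fin 3)) 𝓘(ℝ, EuclideanSpace ℝ (Fin 4))
          (fun p : EuclideanSpace ℝ (Fin 3) => (E ((BoundaryManifold.boundaryData 3 (Base g)).incl
            (seamDiffeo bX (bBase g) Ψ ((beltMap D j).boundaryTube.toHomeo (circlePt (p 2), L p))))).1)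
          (EuclideanSpace.single (2 : Fin 3) φ) (EuclideanSpace.single (2 : Fin 3) (1 : ℝ))) =
      det4 (gradient (rho g) (E ((BoundaryManifold.boundaryData 3 (Base g)).incl (seamDiffeo bX (bBase g) Ψ
          ((beltMap D j).boundaryTube.toHomeo (circlePt φ, (0 : EuclideanSpace ℝ (Fin 2))))))).1)
        (fderiv ℝ (fun m : EuclideanSpace ℝ (Fin 2) => (E ((BoundaryManifold.boundaryData 3 (Base g)).incl
          (seamDiffeo bX (bBase g) Ψ ((beltMap D j).boundaryTube.toHomeo (circlePt φ, m))))).1) 0 planeE0)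
        (fderiv ℝ (fun m : EuclideanSpace ℝ (Fin 2) => (E ((BoundaryManifold.boundaryData 3 (Base g)).incl
          (seamDiffeo bX (bBase g) Ψ ((beltMap D j).boundaryTube.toHomeo (circlePt φ, m))))).1) 0 planeE1)
        (deriv (ambCurve g (fun θ => E ((BoundaryManifold.boundaryData 3 (Base g)).incl
          (seamDiffeo bX (bBase g) Ψ ((beltMap D j).boundaryTube.toHomeo (θ, (0 : EuclideanSpace ℝ (Fin 2)))))))) φ) := by
  obtain ⟨hcol, h2⟩ := mfderiv_beltChart₃_single D bX Ψ E j hL φ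
  have h0 := hcol planeE0
  have h1 := hcol planeE1
  have e0 : (planeE0 0 • EuclideanSpace.single (0 : Fin 3) (1 : ℝ) + planeE0 1 • EuclideanSpace.single (1 : Fin 3) (1 : ℝ)) =
      EuclideanSpace.single (0 : Fin 3) (1 : ℝ) := by
    ext i; fin_cases i <;> simp [planeE0]
  have e1 : (planeE1 0 • EuclideanSpace.single (0 : Fin 3) (1 : ℝ) + planeE1 1 • EuclideanSpace.single (1 : Fin 3) (1 : ℝ)) =
      EuclideanSpace.single (1 : Fin 3) (1 : ℝ) := by
    ext i; fin_cases i <;> simp [planeE1]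
  rw [e0] at h0
  rw [e1] at h1
  rw [h0, h1, h2, beltChart₃_single D bX Ψ E j hL φ]

/-! ## §3 Riders: the frame hypotheses of `helper_det4_beltFrame_sign` -/

/-- **The velocity of the pushed dual circle never vanishes**: `T = dΓ̂ e₂ ≠ 0` (`dΓ̂` is injective).
[cite: Kosinski1993, VI §6] -/
theorem beltFrame_T_ne_zero
    (hL : ∀ (p : EuclideanSpace ℝ (Fin 3)) (i : Fin 2), L p i = p (Fin.castSucc i)) (φ : ℝ) :
    deriv (ambCurve g (fun θ => E ((BoundaryManifold.boundaryData 3 (Base g)).incl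
      (seamDiffeo bX (bBase g) Ψ ((beltMap D j).boundaryTube.toHomeo (θ, (0 : EuclideanSpace ℝ (Fin 2)))))))) φ ≠ 0 := by
  have hp0 : ‖L (EuclideanSpace.single (2 : Fin 3) φ)‖ < 1 := by
    rw [lamL3_single hL, norm_zero]; exact one_pos
  obtain ⟨Dp, hinj, hD⟩ := hasMFDerivAt_beltChart₃ D bX Ψ E j hL (EuclideanSpace.single (2 : Fin 3) φ) hp0
  have hv : ∀ v : EuclideanSpace ℝ (Fin 3), mfderiv 𝓘(ℝ, EuclideanSpace ℝ (Fin 3)) 𝓘(ℝ, EuclideanSpace ℝ (Fin 4))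
      (fun p : EuclideanSpace ℝ (Fin 3) => (E ((BoundaryManifold.boundaryData 3 (Base g)).incl
        (seamDiffeo bX (bBase g) Ψ ((beltMap D j).boundaryTube.toHomeo (circlePt (p 2), L p))))).1)
      (EuclideanSpace.single (2 : Fin 3) φ) v = Dp v := fun v => by
    rw [hD.mfderiv]; rfl
  rw [← (mfderiv_beltChart₃_single D bX Ψ E j hL φ).2, hv]
  intro h0
  have h1 : EuclideanSpace.single (2 : Fin 3) (1 : ℝ) = 0 := hinj (h0.trans (map_zero _).symm)
  exact absurd h1 (by simp)

/-- **The fibre derivative of the two-dimensional chart is tangent to the boundary**: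
`d rho (Λ X) = 0` for all `X`. [folklore] -/
theorem beltFrame_rho
    (hL : ∀ (p : EuclideanSpace ℝ (Fin 3)) (i : Fin 2), L p i = p (Fin.castSucc i))
    (hEρ : ∀ x : Base g, rho g (E x).1 = rho g x.1) (φ : ℝ) (Xv : EuclideanSpace ℝ (Fin 2)) :
    fderiv ℝ (rho g) (E ((BoundaryManifold.boundaryData 3 (Base g)).incl (seamDiffeo bX (bBase g) Ψ
        ((beltMap D j).boundaryTube.toHomeo (circlePt φ, (0 : EuclideanSpace ℝ (Fin 2))))))).1
      (fderiv ℝ (fun m : EuclideanSpace ℝ (Fin 2) => (E ((BoundaryManifold.boundaryData 3 (Base g)).incl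
        (seamDiffeo bX (bBase g) Ψ ((beltMap D j).boundaryTube.toHomeo (circlePt φ, m))))).1) 0 Xv) = 0 := by
  have hp0 : ‖L (EuclideanSpace.single (2 : Fin 3) φ)‖ < 1 := by
    rw [lamL3_single hL, norm_zero]; exact one_pos
  rw [← (mfderiv_beltChart₃_single D bX Ψ E j hL φ).1 Xv, ← beltChart₃_single D bX Ψ E j hL φ]
  exact fderiv_rho_beltChart₃ D bX Ψ E j hL hEρ _ hp0 _

/-- **The fibre plane meets the dual circle direction only at zero**: `Λ X = a • T ⇒ X = 0`
(`dΓ̂ (X, -a) = 0` and `dΓ̂` is injective). [cite: Kosinski1993, VI §6] -/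
theorem beltFrame_inj
    (hL : ∀ (p : EuclideanSpace ℝ (Fin 3)) (i : Fin 2), L p i = p (Fin.castSucc i)) (φ : ℝ)
    (Xv : EuclideanSpace ℝ (Fin 2)) (a : ℝ)
    (hXa : fderiv ℝ (fun m : EuclideanSpace ℝ (Fin 2) => (E ((BoundaryManifold.boundaryData 3 (Base g)).incl
        (seamDiffeo bX (bBase g) Ψ ((beltMap D j).boundaryTube.toHomeo (circlePt φ, m))))).1) 0 Xv =
      a • deriv (ambCurve g (fun θ => E ((BoundaryManifold.boundaryData 3 (Base g)).incl
        (seamDiffeo bX (bBase g) Ψ ((beltMap D j).boundaryTube.toHomeo (θ, (0 : EuclideanSpace ℝ (Fin 2)))))))) φ) :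
    Xv = 0 := by
  have hp0 : ‖L (EuclideanSpace.single (2 : Fin 3) φ)‖ < 1 := by
    rw [lamL3_single hL, norm_zero]; exact one_pos
  obtain ⟨hcol, h2⟩ := mfderiv_beltChart₃_single D bX Ψ E j hL φ
  obtain ⟨Dp, hinj, hD⟩ := hasMFDerivAt_beltChart₃ D bX Ψ E j hL (EuclideanSpace.single (2 : Fin 3) φ) hp0
  have hv : ∀ v : EuclideanSpace ℝ (Fin 3), mfderiv 𝓘(ℝ, EuclideanSpace ℝ (Fin 3)) 𝓘(ℝ, EuclideanSpace ℝ (Fin 4))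
      (fun p : EuclideanSpace ℝ (Fin 3) => (E ((BoundaryManifold.boundaryData 3 (Base g)).incl
        (seamDiffeo bX (bBase g) Ψ ((beltMap D j).boundaryTube.toHomeo (circlePt (p 2), L p))))).1)
      (EuclideanSpace.single (2 : Fin 3) φ) v = Dp v := fun v => by
    rw [hD.mfderiv]; rfl
  rw [← hcol Xv, ← h2, hv, hv, ← map_smul, ← sub_eq_zero, ← map_sub] at hXa
  have h0 := hinj (hXa.trans (map_zero _).symm)
  ext i
  have h1 := congrArg (fun v : EuclideanSpace ℝ (Fin 3) => v (Fin.castSucc i)) h0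
  simp only [PiLp.sub_apply, PiLp.smul_apply, PiLp.zero_apply] at h1
  rw [embL3_apply_castSucc] at h1
  have : (EuclideanSpace.single (2 : Fin 3) (1 : ℝ)) (Fin.castSucc i) = 0 := by
    fin_cases i <;> simp
  rw [this, smul_zero, sub_zero] at h1
  rw [h1]; rfl

end Chart

/-- **Sub-goal `helper_beltChar_at_belt` of stub `stub_T3_dualPresentation`** (T3 ▸ node `Hgap` ▸ part B
`helper_Hgap_twisting` ▸ transfer step (R6d′), sphere side; wave 7, lead c5, worker H1): at a belt point
`p₀ = single 2 φ` the `det4`-orientation character of the three-dimensional belt-tube chart is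
`det4 (∇rho (Γ_φ 0), Λ e₀, Λ e₁, T)`, `Λ` the fibre derivative of the two-dimensional chart, `T` the velocity
of the pushed dual circle (`let`-form of `beltChar_at_belt`). [cite: LeeSmoothManifolds2013, Prop. 3.9] -/
theorem helper_beltChar_at_belt : ∀ (g : ℕ) (ι : Type) [Finite ι] (h : ι → Literature.Topology.FourManifolds.HandleAttachingMap 3 2 (Literature.Topology.FourManifolds.LefschetzBase.Base g)) (X : Type) [TopologicalSpace X] [ChartedSpace (EuclideanHalfSpace 4) X] [IsManifold (𝓡∂ 4) ∞ X] (D : Literature.Topology.FourManifolds.HandleAttachingMap.MultiAttachmentData h (𝓡∂ 4) X) (bX : Literature.Topology.FourManifolds.BoundaryData (𝓡∂ 4) X (𝓡 3)) (Ψ : bX.carrier ≃ₘ⟮𝓡 3, 𝓡 3⟯ (Literature.Topology.FourManifolds.LefschetzBase.bBase g).carrier) (E : Literature.Topology.FourManifolds.LefschetzBase.Base g ≃ₘ^∞⟮𝓡∂ 4, 𝓡∂ 4⟯ Literature.Topology.FourManifolds.LefschetzBase.Base g) (j : ι) (L : EuclideanSpace ℝ (Fin 3) →L[ℝ] EuclideanSpace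 ℝ (Fin 2)), (∀ (p : EuclideanSpace ℝ (Fin 3)) (i : Fin 2), L p i = p (Fin.castSucc i)) → ∀ (φ : ℝ), let Γ : EuclideanSpace ℝ (Fin 3) → EuclideanSpace ℝ (Fin 4) := fun p => (E ((Literature.Topology.FourManifolds.BoundaryManifold.boundaryData 3 (Literature.Topology.FourManifolds.LefschetzBase.Base g)).incl (Summit.SmoothPoincare4.SmoothPoincare4.Theorems.AcyclicBisectionExists.ModpBraidOrbits.seamDiffeo bX (Literature.Topology.FourManifolds.LefschetzBase.bBase g) Ψ ((Summit.SmoothPoincare4.SmoothPoincare4.Theorems.AcyclicBisectionExists.ModpBraidOrbits.beltMap D j).boundaryTube.toHomeo (Literature.Topology.FourManifolds.circlePt (p 2), L p))))).1; let Γ₂ : Metric.sphere (0 : EuclideanSpace ℝ (Fin 2)) 1 → EuclideanSpace ℝ (Fin 2) → Literature.Topology.FourManifolds.LefschetzBase.Base g := fun θ m => E ((Literature.Topology.FourManifolds.BoundaryManifold.boundaryData 3 (Literature.Topology.FourManifolds.LefschetzBase.Base g)).incl (Summit.SmoothPoincare4.SmoothPoincare4.Theorems.AcyclicBisectionExists.ModpBraidOrbits.seamDiffeo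 bX (Literature.Topology.FourManifolds.LefschetzBase.bBase g) Ψ ((Summit.SmoothPoincare4.SmoothPoincare4.Theorems.AcyclicBisectionExists.ModpBraidOrbits.beltMap D j).boundaryTube.toHomeo (θ, m)))); let Λ : EuclideanSpace ℝ (Fin 2) →L[ℝ] EuclideanSpace ℝ (Fin 4) := fderiv ℝ (fun m : EuclideanSpace ℝ (Fin 2) => (Γ₂ (Literature.Topology.FourManifolds.circlePt φ) m).1) 0; Literature.Geometry.Symplectic.det4 (gradient (Literature.Topology.FourManifolds.LefschetzBase.rho g) (Γ (EuclideanSpace.single (2 : Fin 3) φ))) (mfderiv 𝓘(ℝ, EuclideanSpace ℝ (Fin 3)) 𝓘(ℝ, EuclideanSpace ℝ (Fin 4)) Γ (EuclideanSpace.single (2 : Fin 3) φ) (EuclideanSpace.single (0 : Fin 3) (1 : ℝ))) (mfderiv 𝓘(ℝ, EuclideanSpace ℝ (Fin 3)) 𝓘(ℝ, EuclideanSpace ℝ (Fin 4)) Γ (EuclideanSpace.single (2 : Fin 3) φ) (EuclideanSpace.single (1 : Fin 3) (1 : ℝ))) (mfderiv 𝓘(ℝ, EuclideanSpace ℝ (Fin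 3)) 𝓘(ℝ, EuclideanSpace ℝ (Fin 4)) Γ (EuclideanSpace.single (2 : Fin 3) φ) (EuclideanSpace.single (2 : Fin 3) (1 : ℝ))) = Literature.Geometry.Symplectic.det4 (gradient (Literature.Topology.FourManifolds.LefschetzBase.rho g) (Γ₂ (Literature.Topology.FourManifolds.circlePt φ) 0).1) (Λ Literature.Topology.FourManifolds.planeE0) (Λ Literature.Topology.FourManifolds.planeE1) (deriv (Literature.Topology.FourManifolds.LefschetzBase.ambCurve g (fun θ => Γ₂ θ 0)) φ) :=
  fun _ _ _ _ _ _ _ _ D bX Ψ E j _ hL φ => beltChar_at_belt D bX Ψ E j hL φ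

end Summit.SmoothPoincare4.SmoothPoincare4.Theorems.AcyclicBisectionExists.ModpBraidOrbits

end
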